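import Summits.NavierStokesRegularity.NavierStokesRegularity.Theorems.TerminalTraceTypeITraceScarL3LogMeanApexCloser
import Summits.NavierStokesRegularity.NavierStokesRegularity.Theorems.TerminalTraceTypeITraceScarL3SqrtTwoApexWindow
import Summits.NavierStokesRegularity.NavierStokesRegularity.Theorems.TerminalTraceTypeITraceScarL3ApexPackageTranslate
import HarnessLib

/-!
# T28-B «CEILING AND MEAN», UNCONDITIONAL: an extinct Type-I apex whose rate has log-window means `q < 1` on a
# final slab has NO top singular point — Stub LOUD / Stub C in the log-mean window
# (ROUND-28 §3; item `TerminalTrace.TypeITraceScarL3`, stmt-NavierStokesRegularity-18385, Stub LOUD line; helpers)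

Seat nsreg-C26-p1 g2 (cell ns-regularity-ideate), `--supports stmt-NavierStokesRegularity-18385` (helper);
planner-of-record nsreg-p2 g29 (ROUND-28 §3 T28-B; DIRECTOR-NS #130 (2) «T28-C (A)»).  The log-mean twin of
`topSingularSet_eq_empty_of_rateSq_lt_two` (T27-B, `…SqrtTwoApexConsequences`), from the package-level
threshold `one_le_logMean_of_quietShell` (`…LogMeanApexCloser`):

* `ae_rate_translate` — the slab clause `‖U(s, y)‖ ≤ β(s)` a.e. on `]T,0[ × ℝ³` passes to space translates.
* **`no_topSingular_of_logMean_lt_one`** — an extinct Type-I apex package of class `(M, D₀, C)` (ANY `C`)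
  whose velocity obeys on a final slab `]T,0[ × ℝ³` the a.e. rate `‖U(s, y)‖ ≤ β(s)`, `β` continuous,
  `β² ≤ 2p/(−s)`, `p ≥ 0`, `P' = p/(−s)`, with LOG-WINDOW MEANS `q < 1` (hypothesis (LM_q):
  `P(s) − P(s') ≤ q·log((−s')/(−s)) + K₀`, `T < s' ≤ s < 0`) has NO backward-singular point on the top slice.
  Proof (R27 §4 verbatim): were `x` singular, the threshold for the translates (`apexPackage_translate`,
  `ae_rate_translate`; the (LM_q) data are purely temporal and do not move) would exclude quiet shells about
  `x` of every ratio, so every closed shell about `x` meets the closed top singular set `Σ₀`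
  (`quietShell_of_forall_not_isBackwardSingularPoint`), whence `μH[1] Σ₀ ≠ 0` by the sphere trick
  (`hausdorffMeasure_ne_zero_of_meets_every_shell`) — against CKN at the top
  (`hausdorffMeasure_topSingular_apex_eq_zero`).
* `topSingularSet_eq_empty_of_logMean_lt_one` — the same as set emptiness (T28-B as printed: in particular the
  LOUD stub and Stub C hold for every such package, there being no singular apex at all).

Reading (ROUND-28 §3 (3b)): the constant window `C² < 2` of T27-B is the special case `β ≡ C/√(−s)`, `p ≡ q =
C²/2`, `K₀ = 0`; (LM_q) with `q < 1` allows rates whose pointwise constant exceeds `√2` on short log-windows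
(e.g. discretely self-similar profiles are tested by their PERIOD MEAN).  WHAT THIS IS NOT: not T28-C (the
transfer of (LM_q) through the zoom of a blow-up), not Stub LOUD for all packages, NOT a proof of Navier–Stokes
regularity.  [folklore; Ghidaglia 1986; Agmon–Nirenberg 1967; CaffarelliKohnNirenberg1982 Thm B;
Seregin2014 Prop. 6.20]
-/

noncomputable section

set_option linter.dupNamespace false

namespace Summit.NavierStokesRegularity.NavierStokesRegularity.Theorems.TypeITraceScarL3

open MeasureTheory Set Function Filter Topology Metric InnerProductSpace
open Literature.Analysis Literature.Analysis.FluidPDE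
open scoped NNReal ENNReal RealInnerProductSpace ContDiff

/-- The slab rate clause `‖U(s, y)‖ ≤ β(s)` a.e. on `]T,0[ × ℝ³` passes to the space translate
`(s, y) ↦ U(s, y + x)`. [folklore] -/
theorem ae_rate_translate (x : EuclideanSpace ℝ (Fin 3))
    {U : ℝ → EuclideanSpace ℝ (Fin 3) → EuclideanSpace ℝ (Fin 3)} {T : ℝ} {β : ℝ → ℝ}
    (hβU : ∀ᵐ z ∂(volume.restrict (Ioo T 0 ×ˢ (univ : Set (EuclideanSpace ℝ (Fin 3))))),
      ‖U z.1 z.2‖ ≤ β z.1) :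
    ∀ᵐ z ∂(volume.restrict (Ioo T 0 ×ˢ (univ : Set (EuclideanSpace ℝ (Fin 3))))),
      ‖(fun s y => U s (y + x)) z.1 z.2‖ ≤ β z.1 := by
  have h := ae_restrict_comp_translate x (measurableSet_Ioo.prod MeasurableSet.univ) hβU
  have hpre : (fun z : ℝ × EuclideanSpace ℝ (Fin 3) => (z.1, z.2 + x)) ⁻¹'
      (Ioo T 0 ×ˢ (univ : Set (EuclideanSpace ℝ (Fin 3)))) = Ioo T 0 ×ˢ univ := by
    ext z
    simp only [mem_preimage, mem_prod, mem_univ, and_true]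
  rw [hpre] at h
  exact h

/-- **T28-B, unconditional (pointwise form): no top singular point for an extinct Type-I apex package whose
rate has log-window means `q < 1` on a final slab** (module docstring).
[folklore; Ghidaglia 1986; Agmon–Nirenberg 1967; CaffarelliKohnNirenberg1982 Thm B] -/
theorem no_topSingular_of_logMean_lt_one {M D₀ : ℝ≥0} {C : ℝ}
    {U : ℝ → EuclideanSpace ℝ (Fin 3) → EuclideanSpace ℝ (Fin 3)}
    {P : ℝ → EuclideanSpace ℝ (Fin 3) → ℝ}
    {G : ℝ → EuclideanSpace ℝ (Fin 3) → EuclideanSpace ℝ (Fin 3) →L[ℝ] EuclideanSpace ℝ (Fin 3)}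
    (hsw : ∀ a : ℝ, 0 < a →
      IsSuitableWeakSolutionInBall a (0 : ℝ × EuclideanSpace ℝ (Fin 3)) U P)
    (hG : ∀ a : ℝ, 0 < a →
      HasWeakSpatialGradientOn
        (parabolicCylinderOpens a (0 : ℝ × EuclideanSpace ℝ (Fin 3))) U G)
    (hI : ∀ a : ℝ, 0 < a →
      typeIBound (parabolicCylinder a (0 : ℝ × EuclideanSpace ℝ (Fin 3))) U P G ≤ M)
    (hD : ∀ z₀ : ℝ × EuclideanSpace ℝ (Fin 3), z₀.1 ≤ 0 →
      ∀ r : ℝ, 0 < r → cknD r z₀ P ≤ D₀)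
    (hrate : ∀ s : ℝ, s < 0 →
      ∀ᵐ y : EuclideanSpace ℝ (Fin 3), ‖U s y‖ ≤ C / Real.sqrt (-s))
    (htop : ∀ φ : EuclideanSpace ℝ (Fin 3) → EuclideanSpace ℝ (Fin 3),
      ContDiff ℝ (⊤ : ℕ∞) φ →
      HasCompactSupport φ → ∀ ε : ℝ, 0 < ε →
      ∃ s₀ : ℝ, s₀ < 0 ∧ ∀ᵐ s ∂(volume.restrict (Ioo s₀ 0)), |∫ y, ⟪U s y, φ y⟫| ≤ ε)
    {T : ℝ} {β p Pβ : ℝ → ℝ} {q K₀ : ℝ} (hT : T < 0) (hK₀ : 0 ≤ K₀)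
    (hβU : ∀ᵐ z ∂(volume.restrict (Ioo T 0 ×ˢ (univ : Set (EuclideanSpace ℝ (Fin 3))))),
      ‖U z.1 z.2‖ ≤ β z.1)
    (hβc : ContinuousOn β (Ioo T 0))
    (hpβ : ∀ s ∈ Ioo T 0, β s ^ 2 ≤ 2 * p s / (-s)) (hpnn : ∀ s ∈ Ioo T 0, 0 ≤ p s)
    (hP : ∀ s ∈ Ioo T 0, HasDerivAt Pβ (p s / (-s)) s)
    (hLM : ∀ s' ∈ Ioo T 0, ∀ s ∈ Ioo T 0, s' ≤ s → Pβ s - Pβ s' ≤ q * Real.log ((-s') / (-s)) + K₀)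
    (hq : q < 1) :
    ∀ x : EuclideanSpace ℝ (Fin 3), ¬ IsBackwardSingularPoint U ((0 : ℝ), x) := by
  intro x hx
  -- every closed shell about `x`, of every ratio, meets the (closed) top singular set
  have hmeet : ∀ R : ℝ, 0 < R → R < 1 → ∀ A : ℝ, 1 < A →
      ∃ y ∈ {y : EuclideanSpace ℝ (Fin 3) | IsBackwardSingularPoint U ((0 : ℝ), y)},
        R ≤ ‖y - x‖ ∧ ‖y - x‖ ≤ A * R := by
    intro R hR _ A hA
    by_contra hno
    simp only [not_exists, not_and, mem_setOf_eq] at hno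
    -- every point of the closed shell about the origin is regular for the translate
    have hreg : ∀ y : EuclideanSpace ℝ (Fin 3), R ≤ ‖y‖ → ‖y‖ ≤ A * R →
        ¬ IsBackwardSingularPoint (fun s y => U s (y + x)) ((0 : ℝ), y) := by
      intro y h1 h2 hy
      rw [isBackwardSingularPoint_translate_iff] at hy
      have e : ‖y + x - x‖ = ‖y‖ := by rw [add_sub_cancel_right]
      exact hno (y + x) hy (by rw [e]; exact h1) (by rw [e]; exact h2)
    obtain ⟨hsw', hG', hI', hD', hrate', htop'⟩ := apexPackage_translate x hsw hG hI hD hrate htop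
    obtain ⟨δ, hδ, R', hR', K, hquiet⟩ := quietShell_of_forall_not_isBackwardSingularPoint hR hA hreg
    have hsing' : IsBackwardSingularPoint (fun s y => U s (y + x)) (0 : ℝ × EuclideanSpace ℝ (Fin 3)) :=
      (isBackwardSingularPoint_translate_zero_iff x U).2 hx
    have h1 := one_le_logMean_of_quietShell M D₀ C _ _ _ hsw' hG' hI' hD' hrate' htop' hsing' A R' δ K
      hA hR' hδ hquiet T β p Pβ q K₀ hT hK₀ (ae_rate_translate x hβU) hβc hpβ hpnn hP hLM
    linarith
  exact hausdorffMeasure_ne_zero_of_meets_every_shell (isClosed_topSingularSet U) x hmeet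
    (hausdorffMeasure_topSingular_apex_eq_zero hsw)

/-- **T28-B, unconditional: the top singular set of an extinct Type-I apex package whose rate has log-window
means `q < 1` on a final slab is EMPTY** — in particular such a package is not backward singular at the origin,
so the LOUD stub and Stub C hold for it. [folklore; CaffarelliKohnNirenberg1982 Thm B] -/
theorem topSingularSet_eq_empty_of_logMean_lt_one {M D₀ : ℝ≥0} {C : ℝ}
    {U : ℝ → EuclideanSpace ℝ (Fin 3) → EuclideanSpace ℝ (Fin 3)}
    {P : ℝ → EuclideanSpace ℝ (Fin 3) → ℝ}
    {G : ℝ → EuclideanSpace ℝ (Fin 3) → EuclideanSpace ℝ (Fin 3) →L[ℝ] EuclideanSpace ℝ (Fin 3)}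
    (hsw : ∀ a : ℝ, 0 < a →
      IsSuitableWeakSolutionInBall a (0 : ℝ × EuclideanSpace ℝ (Fin 3)) U P)
    (hG : ∀ a : ℝ, 0 < a →
      HasWeakSpatialGradientOn
        (parabolicCylinderOpens a (0 : ℝ × EuclideanSpace ℝ (Fin 3))) U G)
    (hI : ∀ a : ℝ, 0 < a →
      typeIBound (parabolicCylinder a (0 : ℝ × EuclideanSpace ℝ (Fin 3))) U P G ≤ M)
    (hD : ∀ z₀ : ℝ × EuclideanSpace ℝ (Fin 3), z₀.1 ≤ 0 →
      ∀ r : ℝ, 0 < r → cknD r z₀ P ≤ D₀)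
    (hrate : ∀ s : ℝ, s < 0 →
      ∀ᵐ y : EuclideanSpace ℝ (Fin 3), ‖U s y‖ ≤ C / Real.sqrt (-s))
    (htop : ∀ φ : EuclideanSpace ℝ (Fin 3) → EuclideanSpace ℝ (Fin 3),
      ContDiff ℝ (⊤ : ℕ∞) φ →
      HasCompactSupport φ → ∀ ε : ℝ, 0 < ε →
      ∃ s₀ : ℝ, s₀ < 0 ∧ ∀ᵐ s ∂(volume.restrict (Ioo s₀ 0)), |∫ y, ⟪U s y, φ y⟫| ≤ ε)
    {T : ℝ} {β p Pβ : ℝ → ℝ} {q K₀ : ℝ} (hT : T < 0) (hK₀ : 0 ≤ K₀)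
    (hβU : ∀ᵐ z ∂(volume.restrict (Ioo T 0 ×ˢ (univ : Set (EuclideanSpace ℝ (Fin 3))))),
      ‖U z.1 z.2‖ ≤ β z.1)
    (hβc : ContinuousOn β (Ioo T 0))
    (hpβ : ∀ s ∈ Ioo T 0, β s ^ 2 ≤ 2 * p s / (-s)) (hpnn : ∀ s ∈ Ioo T 0, 0 ≤ p s)
    (hP : ∀ s ∈ Ioo T 0, HasDerivAt Pβ (p s / (-s)) s)
    (hLM : ∀ s' ∈ Ioo T 0, ∀ s ∈ Ioo T 0, s' ≤ s → Pβ s - Pβ s' ≤ q * Real.log ((-s') / (-s)) + K₀)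
    (hq : q < 1) :
    {x : EuclideanSpace ℝ (Fin 3) | IsBackwardSingularPoint U ((0 : ℝ), x)} = ∅ :=
  Set.eq_empty_of_forall_notMem fun x hx =>
    no_topSingular_of_logMean_lt_one hsw hG hI hD hrate htop hT hK₀ hβU hβc hpβ hpnn hP hLM hq x hx

end Summit.NavierStokesRegularity.NavierStokesRegularity.Theorems.TypeITraceScarL3

end
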